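import Summits.CriticalPhenomena.PercolationContinuityZ3.Theorems.PercNearOneGluingNoHeavyLowerTailEventGluingSharp
import Summits.CriticalPhenomena.PercolationContinuityZ3.Theorems.PercNearOneGluingNoHeavyLowerTailHalfLeSevenForms
import HarnessLib

/-!
# Quantitative additive gluing, II: the LINEAR lower tail of `N = |C(o) ∩ A|` with constant `2`, on every finite weighted graph

Support file (`--supports stmt-CriticalPhenomena-4575`), seat `prim-quant-p1` (lane QUANT, rung R1; proof = the lane lead's paper proof, README V6);
builds on p205010 (kernel theorem, internal audit signed; external expert review pending).  Not on the T1/T2 critical path of the lane (KN §4 consumes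
only Conjecture 3); its value is a new finite-graph inequality — the LINEAR, λ-uniform form of the crux `NoHeavyLowerTail` (whose tree δ(ε) is implicit).
No definitions, no named facts, no sorries; standard axioms.

* `linearLowerTail_two` — if `μ(a ↮ a') ≤ s` for all `a, a' ∈ A` then `μ(1 ≤ N ∧ 2N < |A|) ≤ 2·s·μ(o ↔ A)`.
  Proof: on the event, `o ↔ A` and the number of MISSED relays `|A| − N` exceeds `|A|/2`, so first-moment counting
  (`halfLeSevenForms_mul_measureReal_le_sum_inter`) gives `|A|·μ(E) ≤ 2·Σ_{a'∈A} μ(E ∩ {o ↮ a'})`, and for each `a' ∈ A` the sharp event gluing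
  `EventGluingSharp.eventGluing_sharp` (constant 1, target `c := a' ∈ A` allowed) gives `μ({o ↔ A} ∩ {o ↮ a'}) ≤ s·μ(o ↔ A)`.
* `linearLowerTail_two_mean` — the `E N / 2`-threshold form `μ(1 ≤ N ∧ N < EN/2) ≤ 2·s·μ(o ↔ A)`, `EN = Σ_a μ(o ↔ a) ≤ |A|`.
* `linearLowerTail_const_two` — the binder shape of the crux line's `LinearLowerTail` (`Cruxes/NoHeavyLowerTail/SketchIdeator1.lean:71`, `∃ C, …`,
  with `nConn A o ω` unfolded to `(A.filter fun a => ω ∈ openConn o a).card`; Cruxes files are not importable here) at the explicit constant `C = 2`: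
  `0 ≤ δ → (∀ a a' ∈ A, 1 − δ ≤ μ(a ↔ a')) → μ(1 ≤ N ∧ 2N < |A|) ≤ 2·δ` (the sketch's literal form without `0 ≤ δ` is degenerate-false at `A = ∅`,
  see the docstring).
* `qag1_two` — QUANT.md §5 candidate Q-AG1 with `C = 2`: `μ(1 ≤ N ∧ N < EN/2) ≤ 2·(μ(o ↮ A) + s)` for `0 ≤ s` bounding every `μ(a ↮ a')`.
Sharpness window: the INCLUSIVE-threshold `C = 1` form is FALSE (`linearLowerTailInclusive_cex_five`, ratio `20/19`, five vertices), so the sharp constant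
of the strict form lies in `(·, 2]`; lane seat census-1 pins it (exact search n ≤ 7).  [cite: KozmaNitzan2024, Conj. 1 (p. 3), Conjecture 3 (p. 15)]
-/

noncomputable section

namespace Summit.CriticalPhenomena.PercolationContinuityZ3.Theorems

open MeasureTheory Set
open Literature.Probability.LatticeModels (prodBernoulli)
open Literature.Probability.Percolation
open scoped Classical

namespace QuantGluing

variable {n : ℕ}

/-- **Linear lower tail with constant 2** (every finite weighted graph): if `μ(a ↮ a') ≤ s` for all `a, a' ∈ A` then, with
`N = #{a ∈ A : o ↔ a}`, `μ(1 ≤ N ∧ 2N < |A|) ≤ 2·s·μ(o ↔ A)`.  First-moment counting of the missed relays on the event plus the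
sharp event gluing `μ({o ↔ A} ∩ {o ↮ a'}) ≤ s·μ(o ↔ A)` for every `a' ∈ A`. [cite: KozmaNitzan2024, Conj. 1 (p. 3)] -/
theorem linearLowerTail_two (n : ℕ) (w : Sym2 (Fin n) → unitInterval) (A : Finset (Fin n)) (o : Fin n) (s : ℝ)
    (hs : ∀ a ∈ A, ∀ a' ∈ A, (prodBernoulli w).real (openConn a a' : Set (BondConfig (Fin n)))ᶜ ≤ s) :
    (prodBernoulli w).real {ω : BondConfig (Fin n) | 1 ≤ (A.filter fun a => ω ∈ openConn o a).card ∧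
        2 * (A.filter fun a => ω ∈ openConn o a).card < A.card} ≤
      2 * s * (prodBernoulli w).real (⋃ a ∈ A, openConn o a) := by
  set μ := prodBernoulli w with hμ
  have hmeas : ∀ S : Set (BondConfig (Fin n)), MeasurableSet S := fun S => (Set.toFinite S).measurableSet
  set E : Set (BondConfig (Fin n)) := {ω | 1 ≤ (A.filter fun a => ω ∈ openConn o a).card ∧
      2 * (A.filter fun a => ω ∈ openConn o a).card < A.card} with hE
  set U : Set (BondConfig (Fin n)) := ⋃ a ∈ A, openConn o a with hU
  -- `E ⊆ {o ↔ A}`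
  have hEU : E ⊆ U := by
    intro ω hω
    obtain ⟨h1, -⟩ := hω
    obtain ⟨a, ha⟩ := Finset.card_pos.1 h1
    rw [Finset.mem_filter] at ha
    exact Set.mem_biUnion (Finset.mem_coe.2 ha.1) ha.2
  -- counting: `(|A|/2)·μ(E) ≤ Σ_{a'} μ(E ∩ {o ↮ a'})`
  have hcount : (A.card : ℝ) / 2 * μ.real E ≤
      ∑ a' ∈ A, μ.real (E ∩ (openConn o a' : Set (BondConfig (Fin n)))ᶜ) := by
    refine halfLeSevenForms_mul_measureReal_le_sum_inter μ A
      (fun a' => (openConn o a' : Set (BondConfig (Fin n)))ᶜ) (fun a _ => hmeas _) (hmeas E) ((A.card : ℝ) / 2)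
      fun ω hω => ?_
    rw [← halfLeSevenForms_card_filter_eq_sum_indicator]
    have hsplit := Finset.card_filter_add_card_filter_not (s := A) (fun a => ω ∈ openConn o a)
    obtain ⟨-, h2⟩ := hω
    have hcast : ((A.filter fun a => ω ∈ openConn o a).card : ℝ) +
        ((A.filter fun a => ¬ ω ∈ openConn o a).card : ℝ) = A.card := by
      exact_mod_cast hsplit
    have h2' : 2 * ((A.filter fun a => ω ∈ openConn o a).card : ℝ) < A.card := by
      exact_mod_cast h2
    have hrw : ((A.filter fun a => ω ∈ (openConn o a : Set (BondConfig (Fin n)))ᶜ).card : ℝ) =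
        ((A.filter fun a => ¬ ω ∈ openConn o a).card : ℝ) := rfl
    linarith
  -- each missed relay: `μ(E ∩ {o ↮ a'}) ≤ μ({o ↔ A} ∩ {o ↮ a'}) ≤ s·μ(o ↔ A)`
  have hterm : ∀ a' ∈ A, μ.real (E ∩ (openConn o a' : Set (BondConfig (Fin n)))ᶜ) ≤ s * μ.real U := by
    intro a' ha'
    have h := EventGluingSharp.eventGluing_sharp n w A o a' s fun a ha => hs a ha a' ha'
    rw [← hμ] at h
    exact (measureReal_mono (Set.inter_subset_inter_left _ hEU) (measure_ne_top _ _)).trans h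
  rcases A.eq_empty_or_nonempty with hAe | hne
  · -- no relays: the event is empty and so is `{o ↔ A}`
    have hE0 : μ.real E = 0 := by
      have : E = ∅ := by
        rw [Set.eq_empty_iff_forall_notMem]
        intro ω hω
        obtain ⟨h1, -⟩ := hω
        rw [hAe, Finset.filter_empty, Finset.card_empty] at h1
        exact absurd h1 (by norm_num)
      rw [this, measureReal_empty]
    have hU0 : μ.real U = 0 := by
      have : U = ∅ := by rw [hU, hAe]; simp
      rw [this, measureReal_empty]
    rw [hE0, hU0]; simp
  · have hpos : (0 : ℝ) < A.card := by exact_mod_cast Finset.card_pos.2 hne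
    have hsum : ∑ a' ∈ A, μ.real (E ∩ (openConn o a' : Set (BondConfig (Fin n)))ᶜ) ≤ A.card * (s * μ.real U) := by
      calc ∑ a' ∈ A, μ.real (E ∩ (openConn o a' : Set (BondConfig (Fin n)))ᶜ)
          ≤ ∑ a' ∈ A, s * μ.real U := Finset.sum_le_sum hterm
        _ = A.card * (s * μ.real U) := by simp
    have hkey : (A.card : ℝ) * μ.real E ≤ A.card * (2 * s * μ.real U) := by nlinarith [hcount, hsum]
    exact le_of_mul_le_mul_left hkey hpos

/-- **Mean-threshold form**: with `EN := Σ_{a∈A} μ(o ↔ a)` (`= E N`), `μ(1 ≤ N ∧ N < EN/2) ≤ 2·s·μ(o ↔ A)` whenever `μ(a ↮ a') ≤ s` on `A × A`;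
since `EN ≤ |A|`, the event lies in that of `linearLowerTail_two`. [cite: KozmaNitzan2024, Conjecture 3 (p. 15)] -/
theorem linearLowerTail_two_mean (n : ℕ) (w : Sym2 (Fin n) → unitInterval) (A : Finset (Fin n)) (o : Fin n) (s : ℝ)
    (hs : ∀ a ∈ A, ∀ a' ∈ A, (prodBernoulli w).real (openConn a a' : Set (BondConfig (Fin n)))ᶜ ≤ s) :
    (prodBernoulli w).real {ω : BondConfig (Fin n) | 1 ≤ (A.filter fun a => ω ∈ openConn o a).card ∧
        ((A.filter fun a => ω ∈ openConn o a).card : ℝ) <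
          (∑ a ∈ A, (prodBernoulli w).real (openConn o a)) / 2} ≤
      2 * s * (prodBernoulli w).real (⋃ a ∈ A, openConn o a) := by
  have hEN : (∑ a ∈ A, (prodBernoulli w).real (openConn o a : Set (BondConfig (Fin n)))) ≤ A.card := by
    calc (∑ a ∈ A, (prodBernoulli w).real (openConn o a : Set (BondConfig (Fin n)))) ≤ ∑ a ∈ A, (1 : ℝ) :=
          Finset.sum_le_sum fun a _ => measureReal_le_one
      _ = A.card := by simp
  refine (measureReal_mono ?_ (measure_ne_top _ _)).trans (linearLowerTail_two n w A o s hs)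
  intro ω hω
  obtain ⟨h1, h2⟩ := hω
  refine ⟨h1, ?_⟩
  have : 2 * ((A.filter fun a => ω ∈ openConn o a).card : ℝ) < A.card := by linarith
  exact_mod_cast this

/-- **The crux line's `LinearLowerTail` at the explicit constant `C = 2`** (binder shape of
`Cruxes/NoHeavyLowerTail/SketchIdeator1.lean:71` with `nConn` unfolded, plus `0 ≤ δ`): if `0 ≤ δ` and `1 − δ ≤ μ(a ↔ a')` for all
`a, a' ∈ A` then `μ(1 ≤ N ∧ 2N < |A|) ≤ 2·δ` (no hypothesis on `o`).  The side condition `0 ≤ δ` is automatic when `A ≠ ∅` (take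
`a = a'`) and cannot be dropped when `A = ∅`: there the reliability hypothesis is vacuous, so the sketch's literal `∃ C, ∀ … δ, … ≤ C·δ`
would force `C·δ ≥ 0` for negative `δ`, i.e. `C = 0` — a degenerate misstatement of that sketch, recorded here rather than repaired there.
[cite: KozmaNitzan2024, Conjecture 3 (p. 15)] -/
theorem linearLowerTail_const_two :
    ∀ (n : ℕ) (w : Sym2 (Fin n) → unitInterval) (A : Finset (Fin n)) (o : Fin n) (δ : ℝ), 0 ≤ δ →
      (∀ a ∈ A, ∀ a' ∈ A, 1 - δ ≤ (prodBernoulli w).real (openConn a a')) →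
      (prodBernoulli w).real {ω : BondConfig (Fin n) | 1 ≤ (A.filter fun a => ω ∈ openConn o a).card ∧
          2 * (A.filter fun a => ω ∈ openConn o a).card < A.card} ≤ 2 * δ := by
  intro n w A o δ hδ0 hδ
  have hmeas : ∀ S : Set (BondConfig (Fin n)), MeasurableSet S := fun S => (Set.toFinite S).measurableSet
  have hs : ∀ a ∈ A, ∀ a' ∈ A, (prodBernoulli w).real (openConn a a' : Set (BondConfig (Fin n)))ᶜ ≤ δ := by
    intro a ha a' ha'
    rw [probReal_compl_eq_one_sub (hmeas _)]
    linarith [hδ a ha a' ha']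
  refine (linearLowerTail_two n w A o δ hs).trans ?_
  have hU : (prodBernoulli w).real (⋃ a ∈ A, openConn o a : Set (BondConfig (Fin n))) ≤ 1 := measureReal_le_one
  nlinarith

/-- **Q-AG1 with `C = 2`** (QUANT.md §5; LADDER R1): for `0 ≤ s` with `μ(a ↮ a') ≤ s` on `A × A`,
`μ(1 ≤ N ∧ N < EN/2) ≤ 2·(μ(o ↮ A) + s)` — in fact already `≤ 2·s·μ(o ↔ A)` (`linearLowerTail_two_mean`); the `μ(o ↮ A)` term is not needed.
[cite: KozmaNitzan2024, Conjecture 3 (p. 15)] -/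
theorem qag1_two (n : ℕ) (w : Sym2 (Fin n) → unitInterval) (A : Finset (Fin n)) (o : Fin n) (s : ℝ) (hs0 : 0 ≤ s)
    (hs : ∀ a ∈ A, ∀ a' ∈ A, (prodBernoulli w).real (openConn a a' : Set (BondConfig (Fin n)))ᶜ ≤ s) :
    (prodBernoulli w).real {ω : BondConfig (Fin n) | 1 ≤ (A.filter fun a => ω ∈ openConn o a).card ∧
        ((A.filter fun a => ω ∈ openConn o a).card : ℝ) <
          (∑ a ∈ A, (prodBernoulli w).real (openConn o a)) / 2} ≤
      2 * ((prodBernoulli w).real (⋃ a ∈ A, openConn o a : Set (BondConfig (Fin n)))ᶜ + s) := by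
  refine (linearLowerTail_two_mean n w A o s hs).trans ?_
  have hU : (prodBernoulli w).real (⋃ a ∈ A, openConn o a : Set (BondConfig (Fin n))) ≤ 1 := measureReal_le_one
  have hUc : 0 ≤ (prodBernoulli w).real (⋃ a ∈ A, openConn o a : Set (BondConfig (Fin n)))ᶜ := measureReal_nonneg
  nlinarith

end QuantGluing

end Summit.CriticalPhenomena.PercolationContinuityZ3.Theorems

end
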